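import Literature.Computability.Complexity.HardcoreInapproximabilityCyclesOverlap
import HarnessLib

/-!
# Short cycles of Sly's random bipartite core, VI: joint factorial moments across lengths

Allan Sly, *Computational transition at the uniqueness threshold*, FOCS 2010 (arXiv:1005.5584), §3.2
(Lemma 3.7: "the joint factorial moments converge to those of independent Poissons", after MWW09
Lemma 7.3).

For a multiplicity vector `mv : Fin k → ℕ` (that is, `mv i` cycles of length `2(i+1)` for each
`i < k`), the product `Π_i slyDistinctTuples n m' q (i+1) (mv i) ω = Π_i (2(i+1))^{mv i} (X_{2(i+1)})_{mv i}`
counts the families `F : (i : Fin k) → Fin (mv i) → SlyWCycle n q (i+1)` present in `ω` with pairwise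
distinct underlying cycles within each length (`prod_slyDistinctTuples_eq_card`). Parts IV–V are
redone for families (the two-length propagation lemmas of part V give: overlapping members of a
degree-two union have equal edge sets, hence equal lengths and equal underlying cycles), with
`J = Σ_i mv_i (i+1)` in place of `mj`:

* `avg_prod_slyDistinctTuples_ge`: `E[Π_i (2(i+1))^{mv i}(X_{2(i+1)})_{mv i}] ≥ Π_i (q^{2(i+1)}+q)^{mv i} ((n-J)/(n+m'))^{2J}`;
* `avg_prod_slyDistinctTuples_le`: `… ≤ Π_i (q^{2(i+1)}+q)^{mv i} (n/x)^{2J} + (J+1)² (J²(q+1)²)^J (n/x)^{2J}/x`, `x = n-2J`.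

Hence `E[Π_i [X_{2(i+1)}]_{mv i}] → Π_i λ_{2(i+1)}^{mv i}`, `λ_{2j} = (q^{2j}+q)/(2j)`, with explicit rates —
Lemma 3.7 in full. No named facts.

[cite: Sly2010, Lemma 3.7]
-/

namespace Literature.Computability.Complexity

open Finset

/-! ## Joint factorial moments: families of cycles of several lengths

A family with multiplicity vector `mv : Fin k → ℕ` consists of `mv i` rooted oriented cycles of
half-length `i + 1` (length `2(i+1)`) for each `i < k`:
`F : (i : Fin k) → Fin (mv i) → SlyWCycle n q (i + 1)`. The product over `i` of the counts
`slyDistinctTuples n m' q (i+1) (mv i)` is the number of families that are present with pairwise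
distinct underlying cycles within each length, i.e. `Π_i (2(i+1))^{mv i} (X_{2(i+1)})_{mv i}`, whose
expectation is the joint factorial moment of Lemma 3.7. -/

section Families

variable {n q k : ℕ} {mv : Fin k → ℕ}

/-- The members of a family are indexed by `Σ i, Fin (mv i)`; its plus (or minus) vertex slots by
`Σ i, Fin (mv i) × Fin (i+1)`. The total half-length `J = Σ_i mv_i (i+1)`. [folklore] -/
def slyFamJ (mv : Fin k → ℕ) : ℕ := ∑ i : Fin k, mv i * ((i : ℕ) + 1)

/-- The number of vertex slots is `J`. [folklore] -/
theorem card_slyFamSlots (mv : Fin k → ℕ) :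
    Fintype.card (Σ i : Fin k, Fin (mv i) × Fin ((i : ℕ) + 1)) = slyFamJ mv := by
  rw [Fintype.card_sigma]; unfold slyFamJ
  simp only [Fintype.card_prod, Fintype.card_fin]

/-- `Σ_{members} (half-length) = J`. [folklore] -/
theorem sum_members_length (mv : Fin k → ℕ) : ∑ p : (Σ i : Fin k, Fin (mv i)), ((p.1 : ℕ) + 1) = slyFamJ mv := by
  unfold slyFamJ
  rw [Fintype.sum_sigma]
  refine Finset.sum_congr rfl fun i _ => ?_
  simp only [Finset.sum_const, Finset.card_univ, Fintype.card_fin, smul_eq_mul]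

/-- The union of the coloured edge sets of a family. [folklore] -/
noncomputable def slyFamUnionES (F : (i : Fin k) → Fin (mv i) → SlyWCycle n q ((i : ℕ) + 1)) :
    Finset (Option (Fin q) × Fin n × Fin n) :=
  univ.biUnion fun p : (Σ i : Fin k, Fin (mv i)) => (F p.1 p.2).ES

/-- The plus vertices of a family. [folklore] -/
noncomputable def slyFamPlusVerts (F : (i : Fin k) → Fin (mv i) → SlyWCycle n q ((i : ℕ) + 1)) : Finset (Fin n) :=
  univ.image fun s : (Σ i : Fin k, Fin (mv i) × Fin ((i : ℕ) + 1)) => (F s.1 s.2.1).v s.2.2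

/-- The minus vertices of a family. [folklore] -/
noncomputable def slyFamMinusVerts (F : (i : Fin k) → Fin (mv i) → SlyWCycle n q ((i : ℕ) + 1)) : Finset (Fin n) :=
  univ.image fun s : (Σ i : Fin k, Fin (mv i) × Fin ((i : ℕ) + 1)) => (F s.1 s.2.1).w s.2.2

/-- A family is **vertex-disjoint** iff the global plus and minus slot maps are injective. [folklore] -/
def SlyFamDisjoint (F : (i : Fin k) → Fin (mv i) → SlyWCycle n q ((i : ℕ) + 1)) : Prop :=
  (Function.Injective fun s : (Σ i : Fin k, Fin (mv i) × Fin ((i : ℕ) + 1)) => (F s.1 s.2.1).v s.2.2) ∧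
    Function.Injective fun s : (Σ i : Fin k, Fin (mv i) × Fin ((i : ℕ) + 1)) => (F s.1 s.2.1).w s.2.2

/-- A family has **distinct underlying cycles** (within each length). [folklore] -/
def SlyFamDistinct (F : (i : Fin k) → Fin (mv i) → SlyWCycle n q ((i : ℕ) + 1)) : Prop :=
  ∀ i (a b : Fin (mv i)), a ≠ b → (F i a).reps ≠ (F i b).reps

/-- Each member's edge set lies in the union. [folklore] -/
theorem ES_subset_slyFamUnionES (F : (i : Fin k) → Fin (mv i) → SlyWCycle n q ((i : ℕ) + 1)) (i : Fin k) (a : Fin (mv i)) :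
    (F i a).ES ⊆ slyFamUnionES F :=
  Finset.subset_biUnion_of_mem (fun p : (Σ i : Fin k, Fin (mv i)) => (F p.1 p.2).ES) (Finset.mem_univ (⟨i, a⟩ : Σ i : Fin k, Fin (mv i)))

/-- Membership in the union. [folklore] -/
theorem mem_slyFamUnionES {F : (i : Fin k) → Fin (mv i) → SlyWCycle n q ((i : ℕ) + 1)} {ε : Option (Fin q) × Fin n × Fin n} :
    ε ∈ slyFamUnionES F ↔ ∃ (i : Fin k) (a : Fin (mv i)) (e : Fin ((i : ℕ) + 1) ⊕ Fin ((i : ℕ) + 1)), (F i a).edgeOf e = ε := by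
  simp only [slyFamUnionES, Finset.mem_biUnion, Finset.mem_univ, true_and, SlyWCycle.mem_ES]
  constructor
  · rintro ⟨⟨i, a⟩, e, he⟩; exact ⟨i, a, e, he⟩
  · rintro ⟨i, a, e, he⟩; exact ⟨⟨i, a⟩, e, he⟩

/-- `|U| ≤ 2J`. [folklore] -/
theorem card_slyFamUnionES_le (F : (i : Fin k) → Fin (mv i) → SlyWCycle n q ((i : ℕ) + 1)) :
    (slyFamUnionES F).card ≤ 2 * slyFamJ mv := by
  unfold slyFamUnionES
  refine Finset.card_biUnion_le.trans ?_
  simp_rw [SlyWCycle.card_ES]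
  rw [← Finset.mul_sum]
  apply Nat.mul_le_mul_left
  unfold slyFamJ
  rw [Fintype.sum_sigma]
  refine le_of_eq (Finset.sum_congr rfl fun i _ => ?_)
  simp only [Finset.sum_const, Finset.card_univ, Fintype.card_fin, smul_eq_mul]

/-- Plus vertices of members are plus vertices of the family. [folklore] -/
theorem v_mem_slyFamPlusVerts (F : (i : Fin k) → Fin (mv i) → SlyWCycle n q ((i : ℕ) + 1)) (i : Fin k) (a : Fin (mv i)) (t : Fin ((i : ℕ) + 1)) :
    (F i a).v t ∈ slyFamPlusVerts F :=
  Finset.mem_image.2 ⟨⟨i, a, t⟩, Finset.mem_univ _, rfl⟩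

/-- Minus vertices of members are minus vertices of the family. [folklore] -/
theorem w_mem_slyFamMinusVerts (F : (i : Fin k) → Fin (mv i) → SlyWCycle n q ((i : ℕ) + 1)) (i : Fin k) (a : Fin (mv i)) (t : Fin ((i : ℕ) + 1)) :
    (F i a).w t ∈ slyFamMinusVerts F :=
  Finset.mem_image.2 ⟨⟨i, a, t⟩, Finset.mem_univ _, rfl⟩

/-- `|V⁺| ≤ J`. [folklore] -/
theorem card_slyFamPlusVerts_le (F : (i : Fin k) → Fin (mv i) → SlyWCycle n q ((i : ℕ) + 1)) : (slyFamPlusVerts F).card ≤ slyFamJ mv := by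
  unfold slyFamPlusVerts
  refine Finset.card_image_le.trans ?_
  rw [Finset.card_univ, card_slyFamSlots]

/-- `|V⁻| ≤ J`. [folklore] -/
theorem card_slyFamMinusVerts_le (F : (i : Fin k) → Fin (mv i) → SlyWCycle n q ((i : ℕ) + 1)) : (slyFamMinusVerts F).card ≤ slyFamJ mv := by
  unfold slyFamMinusVerts
  refine Finset.card_image_le.trans ?_
  rw [Finset.card_univ, card_slyFamSlots]

/-- Plus endpoints of union edges are plus vertices. [folklore] -/
theorem plus_mem_of_mem_slyFamUnionES {F : (i : Fin k) → Fin (mv i) → SlyWCycle n q ((i : ℕ) + 1)} {ε : Option (Fin q) × Fin n × Fin n}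
    (h : ε ∈ slyFamUnionES F) : ε.2.1 ∈ slyFamPlusVerts F := by
  obtain ⟨i, a, e, rfl⟩ := mem_slyFamUnionES.1 h
  show (F i a).plusEnd e ∈ _
  rw [SlyWCycle.plusEnd_eq]; exact v_mem_slyFamPlusVerts F i a _

/-- Minus endpoints of union edges are minus vertices. [folklore] -/
theorem minus_mem_of_mem_slyFamUnionES {F : (i : Fin k) → Fin (mv i) → SlyWCycle n q ((i : ℕ) + 1)} {ε : Option (Fin q) × Fin n × Fin n}
    (h : ε ∈ slyFamUnionES F) : ε.2.2 ∈ slyFamMinusVerts F := by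
  obtain ⟨i, a, e, rfl⟩ := mem_slyFamUnionES.1 h
  show (F i a).minusEnd e ∈ _
  rw [SlyWCycle.minusEnd_eq]; exact w_mem_slyFamMinusVerts F i a _

/-- Every plus vertex of a family has degree at least two in the union. [folklore] -/
theorem two_le_famPlusDeg (F : (i : Fin k) → Fin (mv i) → SlyWCycle n q ((i : ℕ) + 1)) {x : Fin n} (hx : x ∈ slyFamPlusVerts F) :
    2 ≤ ((slyFamUnionES F).filter fun ε => ε.2.1 = x).card := by
  obtain ⟨⟨i, a, t⟩, -, rfl⟩ := Finset.mem_image.1 hx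
  have hsub : ({(F i a).edgeOf (Sum.inl t), (F i a).edgeOf (Sum.inr ((finRotate _).symm t))} : Finset _) ⊆
      (slyFamUnionES F).filter fun ε => ε.2.1 = (F i a).v t := by
    intro ε hε
    rw [Finset.mem_insert, Finset.mem_singleton] at hε
    rw [Finset.mem_filter]
    rcases hε with rfl | rfl
    · exact ⟨ES_subset_slyFamUnionES F i a ((F i a).edgeOf_mem_ES _), rfl⟩
    · refine ⟨ES_subset_slyFamUnionES F i a ((F i a).edgeOf_mem_ES _), ?_⟩
      show (F i a).v (finRotate _ ((finRotate _).symm t)) = (F i a).v t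
      rw [Equiv.apply_symm_apply]
  refine le_trans ?_ (Finset.card_le_card hsub)
  rw [Finset.card_pair ((F i a).edgeOf_inl_ne_inr t _)]

/-- Every minus vertex of a family has degree at least two in the union. [folklore] -/
theorem two_le_famMinusDeg (F : (i : Fin k) → Fin (mv i) → SlyWCycle n q ((i : ℕ) + 1)) {y : Fin n} (hy : y ∈ slyFamMinusVerts F) :
    2 ≤ ((slyFamUnionES F).filter fun ε => ε.2.2 = y).card := by
  obtain ⟨⟨i, a, t⟩, -, rfl⟩ := Finset.mem_image.1 hy
  have hsub : ({(F i a).edgeOf (Sum.inl t), (F i a).edgeOf (Sum.inr t)} : Finset _) ⊆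
      (slyFamUnionES F).filter fun ε => ε.2.2 = (F i a).w t := by
    intro ε hε
    rw [Finset.mem_insert, Finset.mem_singleton] at hε
    rw [Finset.mem_filter]
    rcases hε with rfl | rfl
    · exact ⟨ES_subset_slyFamUnionES F i a ((F i a).edgeOf_mem_ES _), rfl⟩
    · exact ⟨ES_subset_slyFamUnionES F i a ((F i a).edgeOf_mem_ES _), rfl⟩
  refine le_trans ?_ (Finset.card_le_card hsub)
  rw [Finset.card_pair ((F i a).edgeOf_inl_ne_inr t t)]

/-- **`e ≥ v` for families** (bipartite handshake and minimum degree two). [folklore] -/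
theorem card_verts_le_card_slyFamUnionES (F : (i : Fin k) → Fin (mv i) → SlyWCycle n q ((i : ℕ) + 1)) :
    2 * (slyFamPlusVerts F).card ≤ (slyFamUnionES F).card ∧ 2 * (slyFamMinusVerts F).card ≤ (slyFamUnionES F).card := by
  constructor
  · rw [Finset.card_eq_sum_card_fiberwise (fun _ hε => plus_mem_of_mem_slyFamUnionES (Finset.mem_coe.1 hε))]
    calc 2 * (slyFamPlusVerts F).card = ∑ _x ∈ slyFamPlusVerts F, 2 := by rw [Finset.sum_const, smul_eq_mul, mul_comm]
      _ ≤ _ := Finset.sum_le_sum fun x hx => two_le_famPlusDeg F hx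
  · rw [Finset.card_eq_sum_card_fiberwise (fun _ hε => minus_mem_of_mem_slyFamUnionES (Finset.mem_coe.1 hε))]
    calc 2 * (slyFamMinusVerts F).card = ∑ _y ∈ slyFamMinusVerts F, 2 := by rw [Finset.sum_const, smul_eq_mul, mul_comm]
      _ ≤ _ := Finset.sum_le_sum fun y hy => two_le_famMinusDeg F hy

/-- If `e ≤ v` then all degrees are exactly two (families). [folklore] -/
theorem famDegTwo_of_card_le (F : (i : Fin k) → Fin (mv i) → SlyWCycle n q ((i : ℕ) + 1))
    (h : (slyFamUnionES F).card ≤ (slyFamPlusVerts F).card + (slyFamMinusVerts F).card) :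
    (∀ x ∈ slyFamPlusVerts F, ((slyFamUnionES F).filter fun ε => ε.2.1 = x).card = 2) ∧
      ∀ y ∈ slyFamMinusVerts F, ((slyFamUnionES F).filter fun ε => ε.2.2 = y).card = 2 := by
  obtain ⟨h1, h2⟩ := card_verts_le_card_slyFamUnionES F
  have hp : (slyFamUnionES F).card = 2 * (slyFamPlusVerts F).card := by omega
  have hm : (slyFamUnionES F).card = 2 * (slyFamMinusVerts F).card := by omega
  constructor
  · have hs : (∑ _x ∈ slyFamPlusVerts F, 2) = ∑ x ∈ slyFamPlusVerts F, ((slyFamUnionES F).filter fun ε => ε.2.1 = x).card := by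
      rw [← Finset.card_eq_sum_card_fiberwise (fun _ hε => plus_mem_of_mem_slyFamUnionES (Finset.mem_coe.1 hε)),
        Finset.sum_const, smul_eq_mul, mul_comm, hp]
    intro x hx
    exact ((Finset.sum_eq_sum_iff_of_le fun x hx => two_le_famPlusDeg F hx).1 hs x hx).symm
  · have hs : (∑ _y ∈ slyFamMinusVerts F, 2) = ∑ y ∈ slyFamMinusVerts F, ((slyFamUnionES F).filter fun ε => ε.2.2 = y).card := by
      rw [← Finset.card_eq_sum_card_fiberwise (fun _ hε => minus_mem_of_mem_slyFamUnionES (Finset.mem_coe.1 hε)),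
        Finset.sum_const, smul_eq_mul, mul_comm, hm]
    intro y hy
    exact ((Finset.sum_eq_sum_iff_of_le fun y hy => two_le_famMinusDeg F hy).1 hs y hy).symm

end Families

section FamilyOverlapCore

variable {n q k : ℕ} {mv : Fin k → ℕ}

/-- Degree-two data for a member of a family whose union has all degrees two. [folklore] -/
theorem famDegTwo_member {F : (i : Fin k) → Fin (mv i) → SlyWCycle n q ((i : ℕ) + 1)}
    (hdeg : (∀ x ∈ slyFamPlusVerts F, ((slyFamUnionES F).filter fun ε => ε.2.1 = x).card = 2) ∧
      ∀ y ∈ slyFamMinusVerts F, ((slyFamUnionES F).filter fun ε => ε.2.2 = y).card = 2) (i : Fin k) (a : Fin (mv i)) :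
    (∀ y ∈ univ.image (F i a).w, ((slyFamUnionES F).filter fun ε => ε.2.2 = y).card = 2) ∧
      ∀ x ∈ univ.image (F i a).v, ((slyFamUnionES F).filter fun ε => ε.2.1 = x).card = 2 := by
  constructor
  · intro y hy
    obtain ⟨t, -, rfl⟩ := Finset.mem_image.1 hy
    exact hdeg.2 _ (w_mem_slyFamMinusVerts F i a t)
  · intro x hx
    obtain ⟨t, -, rfl⟩ := Finset.mem_image.1 hx
    exact hdeg.1 _ (v_mem_slyFamPlusVerts F i a t)

/-- If the union of a family has all degrees two and two members share an edge, they have the same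
coloured edge set. [folklore] -/
theorem ES_eq_of_famDegTwo {F : (i : Fin k) → Fin (mv i) → SlyWCycle n q ((i : ℕ) + 1)}
    (hdeg : (∀ x ∈ slyFamPlusVerts F, ((slyFamUnionES F).filter fun ε => ε.2.1 = x).card = 2) ∧
      ∀ y ∈ slyFamMinusVerts F, ((slyFamUnionES F).filter fun ε => ε.2.2 = y).card = 2)
    {i i' : Fin k} {a : Fin (mv i)} {a' : Fin (mv i')} {e' : Fin ((i' : ℕ) + 1) ⊕ Fin ((i' : ℕ) + 1)}
    (h : (F i' a').edgeOf e' ∈ (F i a).ES) : (F i a).ES = (F i' a').ES := by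
  have hCU := ES_subset_slyFamUnionES F i a
  have hDU := ES_subset_slyFamUnionES F i' a'
  have h1 : (F i' a').ES ⊆ (F i a).ES :=
    SlyWCycle.ES_subset_of_shared_edge (Nat.succ_pos _) hDU hCU (famDegTwo_member hdeg i' a').1 (famDegTwo_member hdeg i' a').2 h
  obtain ⟨e, he⟩ := SlyWCycle.mem_ES.1 h
  have h' : (F i a).edgeOf e ∈ (F i' a').ES := by rw [he]; exact (F i' a').edgeOf_mem_ES _
  have h2 : (F i a).ES ⊆ (F i' a').ES :=
    SlyWCycle.ES_subset_of_shared_edge (Nat.succ_pos _) hCU hDU (famDegTwo_member hdeg i a).1 (famDegTwo_member hdeg i a).2 h'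
  exact Finset.Subset.antisymm h2 h1

/-- **Overlapping families with distinct underlying cycles have more edges than vertices.**
[cite: Sly2010, Lemma 3.7 (proof: overlapping configurations; joint moments)] -/
theorem card_verts_lt_card_slyFamUnionES {F : (i : Fin k) → Fin (mv i) → SlyWCycle n q ((i : ℕ) + 1)}
    (hdist : SlyFamDistinct F) (hnd : ¬SlyFamDisjoint F) :
    (slyFamPlusVerts F).card + (slyFamMinusVerts F).card + 1 ≤ (slyFamUnionES F).card := by
  by_contra hlt
  have hle : (slyFamUnionES F).card ≤ (slyFamPlusVerts F).card + (slyFamMinusVerts F).card := by omega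
  have hdeg := famDegTwo_of_card_le F hle
  -- from equal edge sets to a contradiction
  have key : ∀ (i i' : Fin k) (a : Fin (mv i)) (a' : Fin (mv i')),
      (i ≠ i' ∨ ∃ h : i = i', h ▸ a ≠ a') → (F i a).ES = (F i' a').ES → False := by
    intro i i' a a' hne heq
    by_cases hi : i = i'
    · subst hi
      have ha : a ≠ a' := by
        rcases hne with h | ⟨h, h'⟩
        · exact absurd rfl h
        · exact h'
      have hmem : F i a' ∈ (F i a).reps := SlyWCycle.mem_reps_of_ES_eq (Nat.succ_pos _) heq.symm
      exact hdist i a a' ha (SlyWCycle.reps_eq_of_mem_reps (Nat.succ_pos _) hmem).symm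
    · have := congrArg Finset.card heq
      rw [SlyWCycle.card_ES, SlyWCycle.card_ES] at this
      exact hi (Fin.ext (by omega))
  unfold SlyFamDisjoint at hnd
  rw [not_and_or] at hnd
  rcases hnd with hnd | hnd
  · obtain ⟨⟨i, a, t⟩, ⟨i', a', t'⟩, hvv, hne⟩ :
        ∃ s s' : (Σ i : Fin k, Fin (mv i) × Fin ((i : ℕ) + 1)), (F s.1 s.2.1).v s.2.2 = (F s'.1 s'.2.1).v s'.2.2 ∧ s ≠ s' := by
      by_contra hall
      apply hnd
      intro s s' h
      by_contra hne
      exact hall ⟨s, s', h, hne⟩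
    simp only at hvv
    have hedge : (F i' a').edgeOf (Sum.inl t') ∈ (F i a).ES :=
      SlyWCycle.shared_edge_of_shared_plus (ES_subset_slyFamUnionES F i a) (ES_subset_slyFamUnionES F i' a')
        (hdeg.1 _ (v_mem_slyFamPlusVerts F i a t)) hvv
    have heq := ES_eq_of_famDegTwo hdeg hedge
    refine key i i' a a' ?_ heq
    by_cases hi : i = i'
    · subst hi
      refine Or.inr ⟨rfl, fun ha => ?_⟩
      subst ha
      exact hne (by rw [(F i a).hv hvv])
    · exact Or.inl hi
  · obtain ⟨⟨i, a, t⟩, ⟨i', a', t'⟩, hww, hne⟩ :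
        ∃ s s' : (Σ i : Fin k, Fin (mv i) × Fin ((i : ℕ) + 1)), (F s.1 s.2.1).w s.2.2 = (F s'.1 s'.2.1).w s'.2.2 ∧ s ≠ s' := by
      by_contra hall
      apply hnd
      intro s s' h
      by_contra hne
      exact hall ⟨s, s', h, hne⟩
    simp only at hww
    have hedge : (F i' a').edgeOf (Sum.inl t') ∈ (F i a).ES :=
      SlyWCycle.shared_edge_of_shared_minus (ES_subset_slyFamUnionES F i a) (ES_subset_slyFamUnionES F i' a')
        (hdeg.2 _ (w_mem_slyFamMinusVerts F i a t)) hww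
    have heq := ES_eq_of_famDegTwo hdeg hedge
    refine key i i' a a' ?_ heq
    by_cases hi : i = i'
    · subst hi
      refine Or.inr ⟨rfl, fun ha => ?_⟩
      subst ha
      exact hne (by rw [(F i a).hw hww])
    · exact Or.inl hi

end FamilyOverlapCore

section FamilyCounts

variable {n m' q k : ℕ} {mv : Fin k → ℕ}

open scoped Classical in
/-- **The product of the per-length tuple counts is the number of present families with distinct
underlying cycles within each length**: `Π_i (2(i+1))^{mv i} (X_{2(i+1)})_{mv i} = #families`. [cite: Sly2010, Lemma 3.7 (joint factorial moments)] -/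
theorem prod_slyDistinctTuples_eq_card (mv : Fin k → ℕ) (σ : Fin q → Equiv.Perm (Fin (n + m'))) (τ : Equiv.Perm (Fin n)) :
    ∏ i : Fin k, slyDistinctTuples n m' q ((i : ℕ) + 1) (mv i) σ τ =
      ((univ : Finset ((i : Fin k) → Fin (mv i) → SlyWCycle n q ((i : ℕ) + 1))).filter fun F =>
        (∀ i a, (F i a).Present σ τ) ∧ SlyFamDistinct F).card := by
  unfold slyDistinctTuples
  rw [← Fintype.card_piFinset]
  congr 1
  ext F
  simp only [Fintype.mem_piFinset, Finset.mem_filter, Finset.mem_univ, true_and, SlyFamDistinct]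
  exact ⟨fun h => ⟨fun i => (h i).1, fun i => (h i).2⟩, fun h i => ⟨h.1 i, h.2 i⟩⟩

open scoped Classical in
/-- **Double counting for families**: `Σ_ω Π_i DT_i(ω) = Σ_{F distinct} #{ω ⊇ ⋃ F}`. [cite: Sly2010, Lemma 3.7] -/
theorem sum_prod_slyDistinctTuples (mv : Fin k → ℕ) :
    ∑ ω : (Fin q → Equiv.Perm (Fin (n + m'))) × Equiv.Perm (Fin n), ∏ i : Fin k, slyDistinctTuples n m' q ((i : ℕ) + 1) (mv i) ω.1 ω.2 =
      ∑ F : (i : Fin k) → Fin (mv i) → SlyWCycle n q ((i : ℕ) + 1), if SlyFamDistinct F then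
        Fintype.card {ω : (Fin q → Equiv.Perm (Fin (n + m'))) × Equiv.Perm (Fin n) // ∀ i a, (F i a).Present ω.1 ω.2} else 0 := by
  simp_rw [prod_slyDistinctTuples_eq_card]
  have h : ∀ ω : (Fin q → Equiv.Perm (Fin (n + m'))) × Equiv.Perm (Fin n),
      ((univ : Finset ((i : Fin k) → Fin (mv i) → SlyWCycle n q ((i : ℕ) + 1))).filter fun F =>
        (∀ i a, (F i a).Present ω.1 ω.2) ∧ SlyFamDistinct F).card =
        ∑ F : (i : Fin k) → Fin (mv i) → SlyWCycle n q ((i : ℕ) + 1),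
          if (∀ i a, (F i a).Present ω.1 ω.2) ∧ SlyFamDistinct F then 1 else 0 := by
    intro ω; rw [Finset.card_filter]
  simp_rw [h]
  rw [Finset.sum_comm]
  refine Finset.sum_congr rfl fun F _ => ?_
  by_cases hd : SlyFamDistinct F
  · rw [if_pos hd]
    simp only [and_iff_left hd]
    rw [← Finset.card_filter, Fintype.card_subtype]
  · rw [if_neg hd]
    simp only [iff_false_intro hd, and_false, if_false, Finset.sum_const_zero]

/-- Vertex-disjoint families have distinct underlying cycles. [folklore] -/
theorem famDistinct_of_famDisjoint {F : (i : Fin k) → Fin (mv i) → SlyWCycle n q ((i : ℕ) + 1)} (hF : SlyFamDisjoint F) :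
    SlyFamDistinct F := by
  intro i a b hab heq
  have hmem : F i b ∈ (F i a).reps := heq ▸ SlyWCycle.self_mem_reps (Nat.succ_pos _) (F i b)
  have hr := SlyWCycle.range_v_of_mem_reps hmem
  have : (F i b).v 0 ∈ Set.range (F i a).v := hr ▸ Set.mem_range_self _
  obtain ⟨t, ht⟩ := this
  have := hF.1 (a₁ := ⟨i, a, t⟩) (a₂ := ⟨i, b, 0⟩) ht
  simp only [Sigma.mk.injEq, heq_eq_eq, Prod.mk.injEq, true_and] at this
  exact hab this.1

open scoped Classical in
/-- **Realisations containing a vertex-disjoint family**: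
`#{ω ⊇ ⋃ F} = Π_c (n+m' - K_c(F))! (n - K_τ(F))!`. [cite: Sly2010, Lemma 3.7 (proof)] -/
theorem card_present_family (F : (i : Fin k) → Fin (mv i) → SlyWCycle n q ((i : ℕ) + 1)) (hF : SlyFamDisjoint F) :
    Fintype.card {ω : (Fin q → Equiv.Perm (Fin (n + m'))) × Equiv.Perm (Fin n) // ∀ i a, (F i a).Present ω.1 ω.2} =
      (∏ c : Fin q, (n + m' - ∑ p : (Σ i : Fin k, Fin (mv i)), (F p.1 p.2).colourCount (some c)).factorial) *
        (n - ∑ p : (Σ i : Fin k, Fin (mv i)), (F p.1 p.2).colourCount none).factorial := by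
  let ι := Σ i : Fin k, Fin (mv i) × (Fin ((i : ℕ) + 1) ⊕ Fin ((i : ℕ) + 1))
  let E : Finset ι := univ
  let col : ι → Option (Fin q) := fun p => (F p.1 p.2.1).colour p.2.2
  let pe : ι → Fin n := fun p => (F p.1 p.2.1).plusEnd p.2.2
  let me : ι → Fin n := fun p => (F p.1 p.2.1).minusEnd p.2.2
  have hP : ∀ c, Set.InjOn pe (E.filter fun e => col e = c) := by
    rintro c ⟨i, a, e⟩ hp ⟨i', a', e'⟩ hp' h
    simp only [E, Finset.coe_filter, Finset.mem_univ, true_and, Set.mem_setOf_eq, col] at hp hp'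
    simp only [pe, SlyWCycle.plusEnd_eq] at h
    have hk := hF.1 (a₁ := ⟨i, a, slyPlusIdx _ e⟩) (a₂ := ⟨i', a', slyPlusIdx _ e'⟩) h
    simp only [Sigma.mk.injEq] at hk
    obtain ⟨rfl, hk2⟩ := hk
    simp only [heq_eq_eq, Prod.mk.injEq] at hk2
    obtain ⟨rfl, -⟩ := hk2
    have := (F i a).injOn_plusEnd c (by simpa [SlyWCycle.edgesOf] using hp) (by simpa [SlyWCycle.edgesOf] using hp')
      (by simpa [SlyWCycle.plusEnd_eq] using h)
    rw [this]
  have hM : ∀ c, Set.InjOn me (E.filter fun e => col e = c) := by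
    rintro c ⟨i, a, e⟩ hp ⟨i', a', e'⟩ hp' h
    simp only [E, Finset.coe_filter, Finset.mem_univ, true_and, Set.mem_setOf_eq, col] at hp hp'
    simp only [me, SlyWCycle.minusEnd_eq] at h
    have hk := hF.2 (a₁ := ⟨i, a, slyMinusIdx _ e⟩) (a₂ := ⟨i', a', slyMinusIdx _ e'⟩) h
    simp only [Sigma.mk.injEq] at hk
    obtain ⟨rfl, hk2⟩ := hk
    simp only [heq_eq_eq, Prod.mk.injEq] at hk2
    obtain ⟨rfl, -⟩ := hk2
    have := (F i a).injOn_minusEnd c (by simpa [SlyWCycle.edgesOf] using hp) (by simpa [SlyWCycle.edgesOf] using hp')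
      (by simpa [SlyWCycle.minusEnd_eq] using h)
    rw [this]
  have hcard := card_realisations_with_edges (m' := m') E col pe me hP hM
  have hpres : ∀ ω : (Fin q → Equiv.Perm (Fin (n + m'))) × Equiv.Perm (Fin n),
      (∀ i a, (F i a).Present ω.1 ω.2) ↔
        ((∀ c : Fin q, ∀ e ∈ E.filter (fun e => col e = some c), ω.1 c (Fin.castAdd m' (pe e)) = Fin.castAdd m' (me e)) ∧
          ∀ e ∈ E.filter (fun e => col e = none), ω.2 (pe e) = me e) := by
    intro ω
    simp only [E, Finset.mem_filter, Finset.mem_univ, true_and, col, pe, me]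
    constructor
    · intro h
      refine ⟨fun c e he => ?_, fun e he => ?_⟩
      · obtain ⟨i, a, e⟩ := e
        exact ((F i a).present_iff ω.1 ω.2).1 (h i a) |>.1 c e (by simpa [SlyWCycle.edgesOf] using he)
      · obtain ⟨i, a, e⟩ := e
        exact ((F i a).present_iff ω.1 ω.2).1 (h i a) |>.2 e (by simpa [SlyWCycle.edgesOf] using he)
    · rintro ⟨h1, h2⟩ i a
      refine ((F i a).present_iff ω.1 ω.2).2 ⟨fun c e he => h1 c ⟨i, a, e⟩ (by simpa [SlyWCycle.edgesOf] using he),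
        fun e he => h2 ⟨i, a, e⟩ (by simpa [SlyWCycle.edgesOf] using he)⟩
  have hclass : ∀ c : Option (Fin q), (E.filter fun e => col e = c).card = ∑ p : (Σ i : Fin k, Fin (mv i)), (F p.1 p.2).colourCount c := by
    intro c
    simp only [E, col]
    rw [Finset.card_filter, Fintype.sum_sigma, Fintype.sum_sigma]
    refine Finset.sum_congr rfl fun i _ => ?_
    rw [Fintype.sum_prod_type]
    refine Finset.sum_congr rfl fun a _ => ?_
    rw [← Finset.card_filter, ← (F i a).card_edgesOf c]
    rfl
  classical
  rw [Fintype.card_subtype] at hcard ⊢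
  rw [Finset.filter_congr (fun ω _ => hpres ω), hcard]
  simp only [hclass]

end FamilyCounts

section FamilyMain

variable {n m' q k : ℕ} {mv : Fin k → ℕ}

open scoped Classical in
/-- **Lower bound by the vertex-disjoint families** (exact value of their contribution). [cite: Sly2010, Lemma 3.7 (proof)] -/
theorem sum_famDisjoint_le_sum_prod (mv : Fin k → ℕ) :
    (∑ F : (i : Fin k) → Fin (mv i) → SlyWCycle n q ((i : ℕ) + 1), if SlyFamDisjoint F then
        (∏ c : Fin q, (n + m' - ∑ p : (Σ i : Fin k, Fin (mv i)), (F p.1 p.2).colourCount (some c)).factorial) *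
          (n - ∑ p : (Σ i : Fin k, Fin (mv i)), (F p.1 p.2).colourCount none).factorial else 0) ≤
      ∑ ω : (Fin q → Equiv.Perm (Fin (n + m'))) × Equiv.Perm (Fin n), ∏ i : Fin k, slyDistinctTuples n m' q ((i : ℕ) + 1) (mv i) ω.1 ω.2 := by
  rw [sum_prod_slyDistinctTuples]
  refine Finset.sum_le_sum fun F _ => ?_
  by_cases hF : SlyFamDisjoint F
  · rw [if_pos hF, if_pos (famDistinct_of_famDisjoint hF), card_present_family F hF]
  · rw [if_neg hF]; exact Nat.zero_le _

/-- Vertex-disjoint families with prescribed patterns ↔ pairs of injections of the slots. [folklore] -/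
def slyDisjointFamEquiv (Ξ : (i : Fin k) → Fin (mv i) → SlyColourPattern q ((i : ℕ) + 1)) :
    {F : (i : Fin k) → Fin (mv i) → SlyWCycle n q ((i : ℕ) + 1) // SlyFamDisjoint F ∧ (fun i a => (F i a).pattern) = Ξ} ≃
      ((Σ i : Fin k, Fin (mv i) × Fin ((i : ℕ) + 1)) ↪ Fin n) × ((Σ i : Fin k, Fin (mv i) × Fin ((i : ℕ) + 1)) ↪ Fin n) where
  toFun F := (⟨fun s => (F.1 s.1 s.2.1).v s.2.2, F.2.1.1⟩, ⟨fun s => (F.1 s.1 s.2.1).w s.2.2, F.2.1.2⟩)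
  invFun VW := ⟨fun i a => ⟨fun t => VW.1 ⟨i, a, t⟩, fun t => VW.2 ⟨i, a, t⟩, (Ξ i a).1.1, (Ξ i a).1.2,
      fun t t' h => by have := VW.1.injective h; simpa using this,
      fun t t' h => by have := VW.2.injective h; simpa using this, (Ξ i a).2.1, (Ξ i a).2.2⟩,
    ⟨⟨fun s s' h => by
        obtain ⟨i, a, t⟩ := s; obtain ⟨i', a', t'⟩ := s'
        exact VW.1.injective h,
      fun s s' h => by
        obtain ⟨i, a, t⟩ := s; obtain ⟨i', a', t'⟩ := s'
        exact VW.2.injective h⟩,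
      funext fun i => funext fun a => rfl⟩⟩
  left_inv F := by
    obtain ⟨F, hF, rfl⟩ := F
    rfl
  right_inv VW := by
    obtain ⟨V, W⟩ := VW
    rfl

open scoped Classical in
/-- The number of vertex-disjoint families with prescribed patterns: `(n^{(J)})²`. [cite: Sly2010, Lemma 3.7 (proof: positions)] -/
theorem card_slyDisjointFam_pattern (Ξ : (i : Fin k) → Fin (mv i) → SlyColourPattern q ((i : ℕ) + 1)) :
    Fintype.card {F : (i : Fin k) → Fin (mv i) → SlyWCycle n q ((i : ℕ) + 1) // SlyFamDisjoint F ∧ (fun i a => (F i a).pattern) = Ξ} =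
      n.descFactorial (slyFamJ mv) * n.descFactorial (slyFamJ mv) := by
  rw [Fintype.card_congr (slyDisjointFamEquiv Ξ), Fintype.card_prod, Fintype.card_embedding_eq, card_slyFamSlots, Fintype.card_fin]

open scoped Classical in
/-- Summing a function of the pattern family over the vertex-disjoint families. [folklore] -/
theorem sum_famDisjoint_pattern {M : Type*} [AddCommMonoid M] (F₀ : ((i : Fin k) → Fin (mv i) → SlyColourPattern q ((i : ℕ) + 1)) → M) :
    (∑ F : (i : Fin k) → Fin (mv i) → SlyWCycle n q ((i : ℕ) + 1), if SlyFamDisjoint F then F₀ (fun i a => (F i a).pattern) else 0) =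
      ∑ Ξ : (i : Fin k) → Fin (mv i) → SlyColourPattern q ((i : ℕ) + 1), (n.descFactorial (slyFamJ mv) * n.descFactorial (slyFamJ mv)) • F₀ Ξ := by
  rw [← Finset.sum_fiberwise_of_maps_to (s := (univ : Finset ((i : Fin k) → Fin (mv i) → SlyWCycle n q ((i : ℕ) + 1))))
    (t := (univ : Finset ((i : Fin k) → Fin (mv i) → SlyColourPattern q ((i : ℕ) + 1)))) (g := fun F i a => (F i a).pattern)
    (fun _ _ => Finset.mem_univ _)]
  refine Finset.sum_congr rfl fun Ξ _ => ?_
  rw [Finset.sum_filter, ← Finset.sum_filter_add_sum_filter_not univ (fun F : (i : Fin k) → Fin (mv i) → SlyWCycle n q ((i : ℕ) + 1) => SlyFamDisjoint F)]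
  rw [Finset.sum_congr rfl (fun F hF => by
      rw [if_pos (Finset.mem_filter.1 hF).2]
      : ∀ F ∈ univ.filter (fun F : (i : Fin k) → Fin (mv i) → SlyWCycle n q ((i : ℕ) + 1) => SlyFamDisjoint F),
        (if (fun i a => (F i a).pattern) = Ξ then (if SlyFamDisjoint F then F₀ (fun i a => (F i a).pattern) else 0) else 0) =
          if (fun i a => (F i a).pattern) = Ξ then F₀ (fun i a => (F i a).pattern) else 0)]
  rw [Finset.sum_congr rfl (fun F hF => by
      rw [if_neg (Finset.mem_filter.1 hF).2, ite_self]
      : ∀ F ∈ univ.filter (fun F : (i : Fin k) → Fin (mv i) → SlyWCycle n q ((i : ℕ) + 1) => ¬SlyFamDisjoint F),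
        (if (fun i a => (F i a).pattern) = Ξ then (if SlyFamDisjoint F then F₀ (fun i a => (F i a).pattern) else 0) else 0) = 0)]
  rw [Finset.sum_const_zero, add_zero, ← Finset.sum_filter, Finset.filter_filter]
  rw [Finset.sum_congr rfl (fun F hF => by rw [(Finset.mem_filter.1 hF).2.2]
      : ∀ F ∈ univ.filter (fun F : (i : Fin k) → Fin (mv i) → SlyWCycle n q ((i : ℕ) + 1) => SlyFamDisjoint F ∧ (fun i a => (F i a).pattern) = Ξ),
        F₀ (fun i a => (F i a).pattern) = F₀ Ξ)]
  rw [Finset.sum_const, ← card_slyDisjointFam_pattern Ξ, ← Fintype.card_subtype]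

/-- The colour counts of a pattern family sum to `2J`. [folklore] -/
theorem sum_fam_count (Ξ : (i : Fin k) → Fin (mv i) → SlyColourPattern q ((i : ℕ) + 1)) :
    ∑ c : Option (Fin q), ∑ p : (Σ i : Fin k, Fin (mv i)), (Ξ p.1 p.2).count c = 2 * slyFamJ mv := by
  rw [Finset.sum_comm]
  simp_rw [SlyColourPattern.sum_count]
  unfold slyFamJ
  rw [Finset.mul_sum, Fintype.sum_sigma]
  refine Finset.sum_congr rfl fun i _ => ?_
  simp only [Finset.sum_const, Finset.card_univ, Fintype.card_fin, smul_eq_mul]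
  ring

/-- The number of pattern families: `Π_i (q^{2(i+1)} + q)^{mv i}`. [folklore] -/
theorem card_fam_patterns (mv : Fin k → ℕ) :
    (Fintype.card ((i : Fin k) → Fin (mv i) → SlyColourPattern q ((i : ℕ) + 1)) : ℝ) =
      ∏ i : Fin k, ((q : ℝ) ^ (2 * ((i : ℕ) + 1)) + q) ^ (mv i) := by
  rw [Fintype.card_pi]
  push_cast
  refine Finset.prod_congr rfl fun i _ => ?_
  rw [Fintype.card_fun, Fintype.card_fin, card_slyColourPattern q ((i : ℕ) + 1) (Nat.le_add_left 1 _)]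
  push_cast
  ring

open scoped Classical in
/-- **The vertex-disjoint main term for families, normalised and bounded on both sides**:
`P ((n - J)/(n+m'))^{2J} ≤ Σ_{F disjoint} #{ω ⊇ ⋃F}/N_tot ≤ P (n/(n-2J))^{2J}`,
`P = Π_i (q^{2(i+1)}+q)^{mv i}`, `J = Σ_i mv_i (i+1)`. [cite: Sly2010, Lemma 3.7 (proof: main term, joint moments)] -/
theorem sum_famDisjoint_div_bounds (mv : Fin k → ℕ) (hn : 2 * slyFamJ mv < n) :
    (∏ i : Fin k, ((q : ℝ) ^ (2 * ((i : ℕ) + 1)) + q) ^ (mv i)) * (((n : ℝ) - slyFamJ mv) / ((n : ℝ) + m')) ^ (2 * slyFamJ mv) ≤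
        (∑ F : (i : Fin k) → Fin (mv i) → SlyWCycle n q ((i : ℕ) + 1), if SlyFamDisjoint F then
          (((∏ c : Fin q, (n + m' - ∑ p : (Σ i : Fin k, Fin (mv i)), (F p.1 p.2).colourCount (some c)).factorial) *
            (n - ∑ p : (Σ i : Fin k, Fin (mv i)), (F p.1 p.2).colourCount none).factorial : ℕ) : ℝ) else 0) /
          ((((n + m').factorial : ℝ) ^ q) * (n.factorial : ℝ)) ∧
      (∑ F : (i : Fin k) → Fin (mv i) → SlyWCycle n q ((i : ℕ) + 1), if SlyFamDisjoint F then
          (((∏ c : Fin q, (n + m' - ∑ p : (Σ i : Fin k, Fin (mv i)), (F p.1 p.2).colourCount (some c)).factorial) *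
            (n - ∑ p : (Σ i : Fin k, Fin (mv i)), (F p.1 p.2).colourCount none).factorial : ℕ) : ℝ) else 0) /
          ((((n + m').factorial : ℝ) ^ q) * (n.factorial : ℝ)) ≤
        (∏ i : Fin k, ((q : ℝ) ^ (2 * ((i : ℕ) + 1)) + q) ^ (mv i)) * ((n : ℝ) / ((n : ℝ) - 2 * slyFamJ mv)) ^ (2 * slyFamJ mv) := by
  set J := slyFamJ mv with hJ
  set G : ((i : Fin k) → Fin (mv i) → SlyColourPattern q ((i : ℕ) + 1)) → ℝ := fun Ξ =>
    (((∏ c : Fin q, (n + m' - ∑ p : (Σ i : Fin k, Fin (mv i)), (Ξ p.1 p.2).count (some c)).factorial) *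
      (n - ∑ p : (Σ i : Fin k, Fin (mv i)), (Ξ p.1 p.2).count none).factorial : ℕ) : ℝ) with hG
  have hsumG : (∑ F : (i : Fin k) → Fin (mv i) → SlyWCycle n q ((i : ℕ) + 1), if SlyFamDisjoint F then
      (((∏ c : Fin q, (n + m' - ∑ p : (Σ i : Fin k, Fin (mv i)), (F p.1 p.2).colourCount (some c)).factorial) *
        (n - ∑ p : (Σ i : Fin k, Fin (mv i)), (F p.1 p.2).colourCount none).factorial : ℕ) : ℝ) else 0) =
      ∑ Ξ : (i : Fin k) → Fin (mv i) → SlyColourPattern q ((i : ℕ) + 1), (n.descFactorial J * n.descFactorial J) • G Ξ := by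
    rw [← sum_famDisjoint_pattern G]
    refine Finset.sum_congr rfl fun F _ => ?_
    simp only [hG, SlyWCycle.colourCount_eq]
  have hterm : ∀ Ξ : (i : Fin k) → Fin (mv i) → SlyColourPattern q ((i : ℕ) + 1),
      ((n.descFactorial J * n.descFactorial J) • G Ξ) / ((((n + m').factorial : ℝ) ^ q) * (n.factorial : ℝ)) =
        (n.descFactorial J : ℝ) ^ 2 /
          ((∏ c : Fin q, ((n + m').descFactorial (∑ p : (Σ i : Fin k, Fin (mv i)), (Ξ p.1 p.2).count (some c)) : ℝ)) *
            (n.descFactorial (∑ p : (Σ i : Fin k, Fin (mv i)), (Ξ p.1 p.2).count none) : ℝ)) := by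
    intro Ξ
    have hkc : ∀ c : Option (Fin q), (∑ p : (Σ i : Fin k, Fin (mv i)), (Ξ p.1 p.2).count c) ≤ n := fun c => by
      have h := Finset.single_le_sum (f := fun c => ∑ p : (Σ i : Fin k, Fin (mv i)), (Ξ p.1 p.2).count c) (fun _ _ => Nat.zero_le _) (Finset.mem_univ c)
      rw [sum_fam_count] at h
      omega
    have hfac : ∀ (N k : ℕ), k ≤ N → ((N - k).factorial : ℝ) = (N.factorial : ℝ) / (N.descFactorial k : ℝ) := by
      intro N k hk
      have hpos : (0 : ℝ) < N.descFactorial k := by exact_mod_cast Nat.descFactorial_pos.2 hk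
      rw [eq_div_iff hpos.ne']
      exact_mod_cast factorial_sub_mul_descFactorial hk
    rw [hG, nsmul_eq_mul]
    push_cast
    have hprod : (∏ c : Fin q, ((n + m' - ∑ p : (Σ i : Fin k, Fin (mv i)), (Ξ p.1 p.2).count (some c)).factorial : ℝ)) =
        ∏ c : Fin q, (((n + m').factorial : ℝ) / ((n + m').descFactorial (∑ p : (Σ i : Fin k, Fin (mv i)), (Ξ p.1 p.2).count (some c)) : ℝ)) :=
      Finset.prod_congr rfl fun c _ => hfac _ _ ((hkc (some c)).trans (Nat.le_add_right n m'))
    rw [hprod, hfac n _ (hkc none), Finset.prod_div_distrib, Finset.prod_const, Finset.card_univ, Fintype.card_fin]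
    have hP : (∏ c : Fin q, ((n + m').descFactorial (∑ p : (Σ i : Fin k, Fin (mv i)), (Ξ p.1 p.2).count (some c)) : ℝ)) ≠ 0 :=
      Finset.prod_ne_zero_iff.2 fun c _ => by
        exact_mod_cast (Nat.descFactorial_pos.2 ((hkc (some c)).trans (Nat.le_add_right n m'))).ne'
    have hD : (n.descFactorial (∑ p : (Σ i : Fin k, Fin (mv i)), (Ξ p.1 p.2).count none) : ℝ) ≠ 0 := by
      exact_mod_cast (Nat.descFactorial_pos.2 (hkc none)).ne'
    have hF1 : ((n + m').factorial : ℝ) ≠ 0 := by exact_mod_cast (Nat.factorial_pos _).ne'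
    have hF2 : (n.factorial : ℝ) ≠ 0 := by exact_mod_cast (Nat.factorial_pos _).ne'
    field_simp
  have hcard : ((Finset.univ : Finset ((i : Fin k) → Fin (mv i) → SlyColourPattern q ((i : ℕ) + 1))).card : ℝ) =
      ∏ i : Fin k, ((q : ℝ) ^ (2 * ((i : ℕ) + 1)) + q) ^ (mv i) := by
    rw [Finset.card_univ, card_fam_patterns]
  rw [hsumG, Finset.sum_div]
  simp_rw [hterm]
  constructor
  · calc (∏ i : Fin k, ((q : ℝ) ^ (2 * ((i : ℕ) + 1)) + q) ^ (mv i)) * (((n : ℝ) - J) / ((n : ℝ) + m')) ^ (2 * J)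
        = ∑ _Ξ : (i : Fin k) → Fin (mv i) → SlyColourPattern q ((i : ℕ) + 1), (((n : ℝ) - J) / ((n : ℝ) + m')) ^ (2 * J) := by
          rw [Finset.sum_const, nsmul_eq_mul, hcard]
      _ ≤ _ := Finset.sum_le_sum fun Ξ _ =>
          (descFactorial_term_bounds n m' J (fun c => ∑ p : (Σ i : Fin k, Fin (mv i)), (Ξ p.1 p.2).count c) (sum_fam_count Ξ) hn).1
  · calc _ ≤ ∑ _Ξ : (i : Fin k) → Fin (mv i) → SlyColourPattern q ((i : ℕ) + 1), ((n : ℝ) / ((n : ℝ) - 2 * J)) ^ (2 * J) :=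
          Finset.sum_le_sum fun Ξ _ =>
            (descFactorial_term_bounds n m' J (fun c => ∑ p : (Σ i : Fin k, Fin (mv i)), (Ξ p.1 p.2).count c) (sum_fam_count Ξ) hn).2
      _ = (∏ i : Fin k, ((q : ℝ) ^ (2 * ((i : ℕ) + 1)) + q) ^ (mv i)) * ((n : ℝ) / ((n : ℝ) - 2 * J)) ^ (2 * J) := by
          rw [Finset.sum_const, nsmul_eq_mul, hcard]

open scoped Classical in
/-- **Lower bound on the joint factorial moments of the cycle counts** (Sly's Lemma 3.7, joint version,
lower half, all `n`): `E[Π_i (2(i+1))^{mv i} (X_{2(i+1)})_{mv i}] ≥ Π_i (q^{2(i+1)}+q)^{mv i} · ((n-J)/(n+m'))^{2J}`.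
[cite: Sly2010, Lemma 3.7] -/
theorem avg_prod_slyDistinctTuples_ge (mv : Fin k → ℕ) (hn : 2 * slyFamJ mv < n) :
    (∏ i : Fin k, ((q : ℝ) ^ (2 * ((i : ℕ) + 1)) + q) ^ (mv i)) * (((n : ℝ) - slyFamJ mv) / ((n : ℝ) + m')) ^ (2 * slyFamJ mv) ≤
      (∑ ω : (Fin q → Equiv.Perm (Fin (n + m'))) × Equiv.Perm (Fin n),
          ((∏ i : Fin k, slyDistinctTuples n m' q ((i : ℕ) + 1) (mv i) ω.1 ω.2 : ℕ) : ℝ)) /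
        ((((n + m').factorial : ℝ) ^ q) * (n.factorial : ℝ)) := by
  have hN : (0 : ℝ) < (((n + m').factorial : ℝ) ^ q) * (n.factorial : ℝ) := by
    have h1 : (0 : ℝ) < (n + m').factorial := by exact_mod_cast Nat.factorial_pos _
    have h2 : (0 : ℝ) < n.factorial := by exact_mod_cast Nat.factorial_pos _
    positivity
  refine (sum_famDisjoint_div_bounds mv hn).1.trans (div_le_div_of_nonneg_right ?_ hN.le)
  have h := sum_famDisjoint_le_sum_prod (n := n) (m' := m') (q := q) mv
  have h' := Nat.cast_le (α := ℝ) |>.2 h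
  push_cast at h' ⊢
  exact h'

end FamilyMain

section FamilyUpper

variable {n m' q k : ℕ} {mv : Fin k → ℕ}

/-- A family is present iff all edges of its union are. [folklore] -/
theorem present_family_iff_union (F : (i : Fin k) → Fin (mv i) → SlyWCycle n q ((i : ℕ) + 1))
    (σ : Fin q → Equiv.Perm (Fin (n + m'))) (τ : Equiv.Perm (Fin n)) :
    (∀ i a, (F i a).Present σ τ) ↔ ∀ ε ∈ slyFamUnionES F, SlyTriplePresent σ τ ε := by
  simp only [SlyWCycle.present_iff_ES, slyFamUnionES, Finset.mem_biUnion, Finset.mem_univ, true_and]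
  constructor
  · rintro h ε ⟨⟨i, a⟩, hε⟩; exact h i a ε hε
  · intro h i a ε hε; exact h ε ⟨⟨i, a⟩, hε⟩

open scoped Classical in
/-- **Probability of the union of a family**: `#{ω ⊇ U(F)} · (n - 2J)^{|U(F)|} ≤ N_tot`. [cite: Sly2010, Lemma 3.7 (proof)] -/
theorem card_present_family_mul_pow_le (F : (i : Fin k) → Fin (mv i) → SlyWCycle n q ((i : ℕ) + 1)) (hn : 2 * slyFamJ mv < n) :
    (Fintype.card {ω : (Fin q → Equiv.Perm (Fin (n + m'))) × Equiv.Perm (Fin n) // ∀ i a, (F i a).Present ω.1 ω.2} : ℝ) *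
        ((n : ℝ) - 2 * slyFamJ mv) ^ (slyFamUnionES F).card ≤
      (((n + m').factorial : ℝ) ^ q) * (n.factorial : ℝ) := by
  classical
  have hNtot : (0 : ℝ) < (((n + m').factorial : ℝ) ^ q) * (n.factorial : ℝ) := by
    have h1 : (0 : ℝ) < (n + m').factorial := by exact_mod_cast Nat.factorial_pos _
    have h2 : (0 : ℝ) < n.factorial := by exact_mod_cast Nat.factorial_pos _
    positivity
  by_cases hempty : IsEmpty {ω : (Fin q → Equiv.Perm (Fin (n + m'))) × Equiv.Perm (Fin n) // ∀ i a, (F i a).Present ω.1 ω.2}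
  · rw [Fintype.card_eq_zero]; simp [hNtot.le]
  rw [not_isEmpty_iff] at hempty
  obtain ⟨⟨ω₀, hω₀⟩⟩ := hempty
  have hω₀' := (present_family_iff_union F ω₀.1 ω₀.2).1 hω₀
  have hP : ∀ c, Set.InjOn (fun ε : Option (Fin q) × Fin n × Fin n => ε.2.1) ((slyFamUnionES F).filter fun ε => ε.1 = c) := by
    intro c ε hε ε' hε' h
    obtain ⟨c₁, p₁, m₁⟩ := ε
    obtain ⟨c₂, p₂, m₂⟩ := ε'
    simp only [Finset.coe_filter, Set.mem_setOf_eq] at hε hε' h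
    obtain ⟨hU1, rfl⟩ := hε
    obtain ⟨hU2, hc2⟩ := hε'
    subst hc2; subst h
    have h1 := hω₀' _ hU1
    have h2 := hω₀' _ hU2
    unfold SlyTriplePresent SlyEdgePresent at h1 h2
    cases c₂ with
    | none =>
      simp only at h1 h2
      rw [h1] at h2; rw [h2]
    | some c =>
      simp only at h1 h2
      rw [h1] at h2; rw [Fin.castAdd_injective _ _ h2]
  have hM : ∀ c, Set.InjOn (fun ε : Option (Fin q) × Fin n × Fin n => ε.2.2) ((slyFamUnionES F).filter fun ε => ε.1 = c) := by
    intro c ε hε ε' hε' h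
    obtain ⟨c₁, p₁, m₁⟩ := ε
    obtain ⟨c₂, p₂, m₂⟩ := ε'
    simp only [Finset.coe_filter, Set.mem_setOf_eq] at hε hε' h
    obtain ⟨hU1, rfl⟩ := hε
    obtain ⟨hU2, hc2⟩ := hε'
    subst hc2; subst h
    have h1 := hω₀' _ hU1
    have h2 := hω₀' _ hU2
    unfold SlyTriplePresent SlyEdgePresent at h1 h2
    cases c₂ with
    | none =>
      simp only at h1 h2
      rw [← h2] at h1; rw [ω₀.2.injective h1]
    | some c =>
      simp only at h1 h2
      rw [← h2] at h1; rw [Fin.castAdd_injective _ _ ((ω₀.1 c).injective h1)]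
  have hcard := card_realisations_with_edges (n := n) (m' := m') (q := q) (slyFamUnionES F)
    (fun ε => ε.1) (fun ε => ε.2.1) (fun ε => ε.2.2) hP hM
  have hpres : ∀ ω : (Fin q → Equiv.Perm (Fin (n + m'))) × Equiv.Perm (Fin n),
      (∀ i a, (F i a).Present ω.1 ω.2) ↔
        ((∀ c : Fin q, ∀ ε ∈ (slyFamUnionES F).filter (fun ε => ε.1 = some c), ω.1 c (Fin.castAdd m' ε.2.1) = Fin.castAdd m' ε.2.2) ∧
          ∀ ε ∈ (slyFamUnionES F).filter (fun ε => ε.1 = none), ω.2 ε.2.1 = ε.2.2) := by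
    intro ω
    rw [present_family_iff_union]
    simp only [Finset.mem_filter]
    constructor
    · intro h
      refine ⟨fun c ε hε => ?_, fun ε hε => ?_⟩
      · have := h ε hε.1; unfold SlyTriplePresent SlyEdgePresent at this; rw [hε.2] at this; exact this
      · have := h ε hε.1; unfold SlyTriplePresent SlyEdgePresent at this; rw [hε.2] at this; exact this
    · rintro ⟨h1, h2⟩ ε hε
      unfold SlyTriplePresent SlyEdgePresent
      obtain ⟨c, p, mi⟩ := ε
      cases c with
      | none => exact h2 _ ⟨hε, rfl⟩
      | some c => exact h1 c _ ⟨hε, rfl⟩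
  rw [Fintype.card_subtype] at hcard ⊢
  rw [Finset.filter_congr (fun ω _ => hpres ω), hcard]
  -- the factorial bound
  have hUle : (slyFamUnionES F).card ≤ 2 * slyFamJ mv := card_slyFamUnionES_le F
  have hcls : ∀ c, ((slyFamUnionES F).filter fun ε => ε.1 = c).card ≤ (slyFamUnionES F).card := fun c => Finset.card_filter_le _ _
  have hfac : ∀ (N k : ℕ), n ≤ N → k ≤ (slyFamUnionES F).card →
      (((N - k).factorial : ℕ) : ℝ) * ((n : ℝ) - 2 * slyFamJ mv) ^ k ≤ (N.factorial : ℝ) := by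
    intro N k hNn hk
    have hkN : k ≤ N := by omega
    have h1 : ((n : ℝ) - 2 * slyFamJ mv) ^ k ≤ (N.descFactorial k : ℝ) := by
      have h := Nat.pow_sub_le_descFactorial N k
      have h' : (((N + 1 - k : ℕ) : ℝ)) ^ k ≤ (N.descFactorial k : ℝ) := by exact_mod_cast h
      refine le_trans (pow_le_pow_left₀ ?_ ?_ k) h'
      · have : ((2 * slyFamJ mv : ℕ) : ℝ) < n := by exact_mod_cast hn
        push_cast at this; linarith
      · rw [Nat.cast_sub (by omega : k ≤ N + 1)]; push_cast
        have : (k : ℝ) ≤ ((2 * slyFamJ mv : ℕ) : ℝ) := by exact_mod_cast (hk.trans hUle)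
        have : (n : ℝ) ≤ N := by exact_mod_cast hNn
        push_cast at *; linarith
    calc (((N - k).factorial : ℕ) : ℝ) * ((n : ℝ) - 2 * slyFamJ mv) ^ k ≤ ((N - k).factorial : ℝ) * (N.descFactorial k : ℝ) :=
          mul_le_mul_of_nonneg_left h1 (Nat.cast_nonneg _)
      _ = (N.factorial : ℝ) := by exact_mod_cast factorial_sub_mul_descFactorial hkN
  have hsplit : ((n : ℝ) - 2 * slyFamJ mv) ^ (slyFamUnionES F).card =
      (∏ c : Fin q, ((n : ℝ) - 2 * slyFamJ mv) ^ ((slyFamUnionES F).filter fun ε => ε.1 = some c).card) *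
        ((n : ℝ) - 2 * slyFamJ mv) ^ ((slyFamUnionES F).filter fun ε => ε.1 = none).card := by
    rw [Finset.prod_pow_eq_pow_sum, ← pow_add,
      Finset.card_eq_sum_card_fiberwise (s := slyFamUnionES F) (t := (univ : Finset (Option (Fin q))))
        (f := fun ε : Option (Fin q) × Fin n × Fin n => ε.1) (fun _ _ => Finset.mem_coe.2 (Finset.mem_univ _)),
      Fintype.sum_option]
    ring_nf
  rw [hsplit]
  simp only [Nat.cast_mul, Nat.cast_prod]
  have hnn : (0 : ℝ) ≤ (n : ℝ) - 2 * slyFamJ mv := by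
    have : ((2 * slyFamJ mv : ℕ) : ℝ) < n := by exact_mod_cast hn
    push_cast at this; linarith
  calc (∏ c : Fin q, (((n + m' - ((slyFamUnionES F).filter fun ε => ε.1 = some c).card).factorial : ℕ) : ℝ)) *
        (((n - ((slyFamUnionES F).filter fun ε => ε.1 = none).card).factorial : ℕ) : ℝ) *
        ((∏ c : Fin q, ((n : ℝ) - 2 * slyFamJ mv) ^ ((slyFamUnionES F).filter fun ε => ε.1 = some c).card) *
          ((n : ℝ) - 2 * slyFamJ mv) ^ ((slyFamUnionES F).filter fun ε => ε.1 = none).card)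
      = (∏ c : Fin q, (((n + m' - ((slyFamUnionES F).filter fun ε => ε.1 = some c).card).factorial : ℕ) : ℝ) *
          ((n : ℝ) - 2 * slyFamJ mv) ^ ((slyFamUnionES F).filter fun ε => ε.1 = some c).card) *
        ((((n - ((slyFamUnionES F).filter fun ε => ε.1 = none).card).factorial : ℕ) : ℝ) *
          ((n : ℝ) - 2 * slyFamJ mv) ^ ((slyFamUnionES F).filter fun ε => ε.1 = none).card) := by
        rw [Finset.prod_mul_distrib]; ring
    _ ≤ (∏ _c : Fin q, ((n + m').factorial : ℝ)) * (n.factorial : ℝ) := by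
        refine mul_le_mul (Finset.prod_le_prod (fun c _ => mul_nonneg (Nat.cast_nonneg _) (pow_nonneg hnn _))
          fun c _ => hfac _ _ (Nat.le_add_right n m') (hcls _)) (hfac _ _ le_rfl (hcls _))
          (mul_nonneg (Nat.cast_nonneg _) (pow_nonneg hnn _)) (Finset.prod_nonneg fun c _ => Nat.cast_nonneg _)
    _ = (((n + m').factorial : ℝ) ^ q) * (n.factorial : ℝ) := by rw [Finset.prod_const, Finset.card_univ, Fintype.card_fin]

open scoped Classical in
/-- **Families supported on prescribed vertex sets**: at most `(|A| |B| (q+1)²)^J` of them. [folklore] -/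
theorem card_families_subset_le (A B : Finset (Fin n)) :
    ((univ : Finset ((i : Fin k) → Fin (mv i) → SlyWCycle n q ((i : ℕ) + 1))).filter fun F =>
        slyFamPlusVerts F ⊆ A ∧ slyFamMinusVerts F ⊆ B).card ≤ (A.card * B.card * ((q + 1) * (q + 1))) ^ slyFamJ mv := by
  let T : (p : Σ i : Fin k, Fin (mv i)) → Finset ((Fin ((p.1 : ℕ) + 1) → Fin n) × (Fin ((p.1 : ℕ) + 1) → Fin n) ×
      (Fin ((p.1 : ℕ) + 1) → Option (Fin q)) × (Fin ((p.1 : ℕ) + 1) → Option (Fin q))) :=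
    fun p => (Fintype.piFinset fun _ => A) ×ˢ ((Fintype.piFinset fun _ => B) ×ˢ (univ ×ˢ univ))
  let g : ((i : Fin k) → Fin (mv i) → SlyWCycle n q ((i : ℕ) + 1)) →
      ((p : Σ i : Fin k, Fin (mv i)) → (Fin ((p.1 : ℕ) + 1) → Fin n) × (Fin ((p.1 : ℕ) + 1) → Fin n) ×
        (Fin ((p.1 : ℕ) + 1) → Option (Fin q)) × (Fin ((p.1 : ℕ) + 1) → Option (Fin q))) :=
    fun F p => ((F p.1 p.2).v, (F p.1 p.2).w, (F p.1 p.2).a, (F p.1 p.2).b)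
  have hmaps : ∀ F ∈ (univ : Finset ((i : Fin k) → Fin (mv i) → SlyWCycle n q ((i : ℕ) + 1))).filter
      (fun F => slyFamPlusVerts F ⊆ A ∧ slyFamMinusVerts F ⊆ B), g F ∈ Fintype.piFinset T := by
    intro F hF
    rw [Finset.mem_filter] at hF
    rw [Fintype.mem_piFinset]
    rintro ⟨i, a⟩
    simp only [T, Finset.mem_product, Fintype.mem_piFinset, Finset.mem_univ, and_true, g]
    exact ⟨fun t => hF.2.1 (v_mem_slyFamPlusVerts F i a t), fun t => hF.2.2 (w_mem_slyFamMinusVerts F i a t)⟩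
  have hinj : Set.InjOn g ((univ : Finset ((i : Fin k) → Fin (mv i) → SlyWCycle n q ((i : ℕ) + 1))).filter
      (fun F => slyFamPlusVerts F ⊆ A ∧ slyFamMinusVerts F ⊆ B)) := by
    intro F _ F' _ h
    funext i a
    have hk := congrFun h ⟨i, a⟩
    simp only [g, Prod.mk.injEq] at hk
    exact SlyWCycle.ext' hk.1 hk.2.1 hk.2.2.1 hk.2.2.2
  refine (Finset.card_le_card_of_injOn g hmaps hinj).trans ?_
  rw [Fintype.card_piFinset]
  have hT : ∀ p : Σ i : Fin k, Fin (mv i), (T p).card = (A.card * B.card * ((q + 1) * (q + 1))) ^ ((p.1 : ℕ) + 1) := by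
    intro p
    simp only [T, Finset.card_product, Fintype.card_piFinset_const, Finset.card_univ, Fintype.card_fun, Fintype.card_fin,
      Fintype.card_option]
    rw [mul_pow, mul_pow, mul_pow]
    ring
  simp_rw [hT]
  rw [Finset.prod_pow_eq_pow_sum, sum_members_length]

open scoped Classical in
/-- **Counting families by their vertex counts.** [cite: Sly2010, Lemma 3.7 (proof: "standard methods")] -/
theorem card_families_verts_le (a b : ℕ) :
    ((univ : Finset ((i : Fin k) → Fin (mv i) → SlyWCycle n q ((i : ℕ) + 1))).filter fun F =>
        (slyFamPlusVerts F).card = a ∧ (slyFamMinusVerts F).card = b).card ≤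
      n.choose a * n.choose b * (a * b * ((q + 1) * (q + 1))) ^ slyFamJ mv := by
  set S := (univ : Finset ((i : Fin k) → Fin (mv i) → SlyWCycle n q ((i : ℕ) + 1))).filter fun F =>
    (slyFamPlusVerts F).card = a ∧ (slyFamMinusVerts F).card = b
  have hmaps : (S : Set ((i : Fin k) → Fin (mv i) → SlyWCycle n q ((i : ℕ) + 1))).MapsTo (fun F => (slyFamPlusVerts F, slyFamMinusVerts F))
      (((Finset.powersetCard a (univ : Finset (Fin n))) ×ˢ (Finset.powersetCard b (univ : Finset (Fin n))) :
        Finset (Finset (Fin n) × Finset (Fin n))) : Set (Finset (Fin n) × Finset (Fin n))) := by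
    intro F hF
    have hF' := (Finset.mem_filter.1 (Finset.mem_coe.1 hF)).2
    rw [Finset.mem_coe, Finset.mem_product, Finset.mem_powersetCard, Finset.mem_powersetCard]
    exact ⟨⟨Finset.subset_univ _, hF'.1⟩, ⟨Finset.subset_univ _, hF'.2⟩⟩
  rw [Finset.card_eq_sum_card_fiberwise hmaps]
  calc ∑ AB ∈ (Finset.powersetCard a (univ : Finset (Fin n))) ×ˢ (Finset.powersetCard b (univ : Finset (Fin n))),
        (S.filter fun F => (slyFamPlusVerts F, slyFamMinusVerts F) = AB).card
      ≤ ∑ AB ∈ (Finset.powersetCard a (univ : Finset (Fin n))) ×ˢ (Finset.powersetCard b (univ : Finset (Fin n))),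
          (AB.1.card * AB.2.card * ((q + 1) * (q + 1))) ^ slyFamJ mv := by
        refine Finset.sum_le_sum fun AB _ => le_trans (Finset.card_le_card ?_) (card_families_subset_le AB.1 AB.2)
        intro F hF
        rw [Finset.mem_filter] at hF ⊢
        obtain ⟨-, h⟩ := hF
        refine ⟨Finset.mem_univ _, ?_, ?_⟩
        · rw [← (Prod.mk.inj h).1]
        · rw [← (Prod.mk.inj h).2]
    _ = ∑ AB ∈ (Finset.powersetCard a (univ : Finset (Fin n))) ×ˢ (Finset.powersetCard b (univ : Finset (Fin n))),
          (a * b * ((q + 1) * (q + 1))) ^ slyFamJ mv := by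
        refine Finset.sum_congr rfl fun AB hAB => ?_
        rw [Finset.mem_product, Finset.mem_powersetCard, Finset.mem_powersetCard] at hAB
        rw [hAB.1.2, hAB.2.2]
    _ = n.choose a * n.choose b * (a * b * ((q + 1) * (q + 1))) ^ slyFamJ mv := by
        rw [Finset.sum_const, Finset.card_product, Finset.card_powersetCard, Finset.card_powersetCard, Finset.card_univ,
          Fintype.card_fin, smul_eq_mul]

end FamilyUpper

section FamilyOverlapBound

variable {n m' q k : ℕ} {mv : Fin k → ℕ}

open scoped Classical in
/-- **The overlapping families contribute `O(1/n)`**: with `x = n - 2J > 0`, `K = (J² (q+1)²)^J`,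
`Σ_{F overlapping, distinct} #{ω ⊇ ⋃F} ≤ N_tot (J+1)² K (n/x)^{2J} / x`. [cite: Sly2010, Lemma 3.7 (proof: overlapping configurations, joint moments)] -/
theorem sum_famOverlap_le (mv : Fin k → ℕ) (hn : 2 * slyFamJ mv < n) :
    (∑ F : (i : Fin k) → Fin (mv i) → SlyWCycle n q ((i : ℕ) + 1), if SlyFamDistinct F ∧ ¬SlyFamDisjoint F then
        (Fintype.card {ω : (Fin q → Equiv.Perm (Fin (n + m'))) × Equiv.Perm (Fin n) // ∀ i a, (F i a).Present ω.1 ω.2} : ℝ) else 0) ≤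
      ((((n + m').factorial : ℝ) ^ q) * (n.factorial : ℝ)) *
        ((((slyFamJ mv + 1) ^ 2 : ℕ) : ℝ) * (((slyFamJ mv * slyFamJ mv * ((q + 1) * (q + 1))) ^ slyFamJ mv : ℕ) : ℝ) *
          (((n : ℝ) / ((n : ℝ) - 2 * slyFamJ mv)) ^ (2 * slyFamJ mv) / ((n : ℝ) - 2 * slyFamJ mv))) := by
  set J := slyFamJ mv with hJ
  set Ntot : ℝ := (((n + m').factorial : ℝ) ^ q) * (n.factorial : ℝ) with hNtot
  set x : ℝ := (n : ℝ) - 2 * J with hx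
  have hNtot0 : 0 < Ntot := by
    have h1 : (0 : ℝ) < (n + m').factorial := by exact_mod_cast Nat.factorial_pos _
    have h2 : (0 : ℝ) < n.factorial := by exact_mod_cast Nat.factorial_pos _
    rw [hNtot]; positivity
  have hx1 : 1 ≤ x := by
    have : ((2 * J + 1 : ℕ) : ℝ) ≤ n := by exact_mod_cast hn
    rw [hx]; push_cast at this ⊢; linarith
  have hx0 : 0 < x := by linarith
  have hnx : 1 ≤ (n : ℝ) / x := by
    rw [le_div_iff₀ hx0, hx]; have : (0 : ℝ) ≤ (J : ℝ) := Nat.cast_nonneg _; linarith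
  set K : ℝ := (((J * J * ((q + 1) * (q + 1))) ^ J : ℕ) : ℝ) with hK
  have hK0 : 0 ≤ K := Nat.cast_nonneg _
  have hterm : ∀ F : (i : Fin k) → Fin (mv i) → SlyWCycle n q ((i : ℕ) + 1),
      (if SlyFamDistinct F ∧ ¬SlyFamDisjoint F then
        (Fintype.card {ω : (Fin q → Equiv.Perm (Fin (n + m'))) × Equiv.Perm (Fin n) // ∀ i a, (F i a).Present ω.1 ω.2} : ℝ) else 0) ≤
      Ntot / x ^ ((slyFamPlusVerts F).card + (slyFamMinusVerts F).card + 1) := by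
    intro F
    split_ifs with h
    · have h1 := card_present_family_mul_pow_le (m' := m') F hn
      rw [← hJ, ← hx, ← hNtot] at h1
      have h2 := card_verts_lt_card_slyFamUnionES h.1 h.2
      rw [le_div_iff₀ (pow_pos hx0 _)]
      calc (Fintype.card {ω : (Fin q → Equiv.Perm (Fin (n + m'))) × Equiv.Perm (Fin n) // ∀ i a, (F i a).Present ω.1 ω.2} : ℝ) *
            x ^ ((slyFamPlusVerts F).card + (slyFamMinusVerts F).card + 1)
          ≤ (Fintype.card {ω : (Fin q → Equiv.Perm (Fin (n + m'))) × Equiv.Perm (Fin n) // ∀ i a, (F i a).Present ω.1 ω.2} : ℝ) *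
            x ^ (slyFamUnionES F).card := mul_le_mul_of_nonneg_left (pow_le_pow_right₀ hx1 h2) (Nat.cast_nonneg _)
        _ ≤ Ntot := h1
    · exact div_nonneg hNtot0.le (pow_nonneg hx0.le _)
  have hfib : (∑ F : (i : Fin k) → Fin (mv i) → SlyWCycle n q ((i : ℕ) + 1), Ntot / x ^ ((slyFamPlusVerts F).card + (slyFamMinusVerts F).card + 1)) =
      ∑ ab ∈ (Finset.range (J + 1)) ×ˢ (Finset.range (J + 1)),
        (((univ : Finset ((i : Fin k) → Fin (mv i) → SlyWCycle n q ((i : ℕ) + 1))).filter fun F =>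
          (slyFamPlusVerts F).card = ab.1 ∧ (slyFamMinusVerts F).card = ab.2).card : ℝ) * (Ntot / x ^ (ab.1 + ab.2 + 1)) := by
    rw [← Finset.sum_fiberwise_of_maps_to (s := (univ : Finset ((i : Fin k) → Fin (mv i) → SlyWCycle n q ((i : ℕ) + 1))))
      (t := (Finset.range (J + 1)) ×ˢ (Finset.range (J + 1)))
      (g := fun F => ((slyFamPlusVerts F).card, (slyFamMinusVerts F).card))
      (fun F _ => Finset.mem_product.2 ⟨Finset.mem_range.2 (Nat.lt_succ_of_le (card_slyFamPlusVerts_le F)),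
        Finset.mem_range.2 (Nat.lt_succ_of_le (card_slyFamMinusVerts_le F))⟩)]
    refine Finset.sum_congr rfl fun ab _ => ?_
    rw [Finset.sum_congr rfl (fun F hF => by
        have h := (Finset.mem_filter.1 hF).2
        rw [← (Prod.mk.inj h).1, ← (Prod.mk.inj h).2]
        : ∀ F ∈ univ.filter (fun F : (i : Fin k) → Fin (mv i) → SlyWCycle n q ((i : ℕ) + 1) =>
            ((slyFamPlusVerts F).card, (slyFamMinusVerts F).card) = ab),
          Ntot / x ^ ((slyFamPlusVerts F).card + (slyFamMinusVerts F).card + 1) = Ntot / x ^ (ab.1 + ab.2 + 1)),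
      Finset.sum_const, nsmul_eq_mul]
    have hfeq : (univ.filter fun F : (i : Fin k) → Fin (mv i) → SlyWCycle n q ((i : ℕ) + 1) =>
        ((slyFamPlusVerts F).card, (slyFamMinusVerts F).card) = ab) =
        univ.filter fun F => (slyFamPlusVerts F).card = ab.1 ∧ (slyFamMinusVerts F).card = ab.2 := by
      ext F; simp [Prod.ext_iff]
    rw [hfeq]
  have hab : ∀ ab ∈ (Finset.range (J + 1)) ×ˢ (Finset.range (J + 1)),
      (((univ : Finset ((i : Fin k) → Fin (mv i) → SlyWCycle n q ((i : ℕ) + 1))).filter fun F =>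
          (slyFamPlusVerts F).card = ab.1 ∧ (slyFamMinusVerts F).card = ab.2).card : ℝ) * (Ntot / x ^ (ab.1 + ab.2 + 1)) ≤
        Ntot * (K * (((n : ℝ) / x) ^ (2 * J) / x)) := by
    intro ab hab
    rw [Finset.mem_product, Finset.mem_range, Finset.mem_range] at hab
    obtain ⟨ha, hb⟩ := hab
    have hcount : (((univ : Finset ((i : Fin k) → Fin (mv i) → SlyWCycle n q ((i : ℕ) + 1))).filter fun F =>
        (slyFamPlusVerts F).card = ab.1 ∧ (slyFamMinusVerts F).card = ab.2).card : ℝ) ≤ (n : ℝ) ^ (ab.1 + ab.2) * K := by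
      have h := card_families_verts_le (n := n) (q := q) (mv := mv) ab.1 ab.2
      have h1 : n.choose ab.1 ≤ n ^ ab.1 := Nat.choose_le_pow n ab.1
      have h2 : n.choose ab.2 ≤ n ^ ab.2 := Nat.choose_le_pow n ab.2
      have h3 : (ab.1 * ab.2 * ((q + 1) * (q + 1))) ^ J ≤ (J * J * ((q + 1) * (q + 1))) ^ J :=
        Nat.pow_le_pow_left (Nat.mul_le_mul (Nat.mul_le_mul (by omega) (by omega)) le_rfl) _
      have h4 : n.choose ab.1 * n.choose ab.2 * (ab.1 * ab.2 * ((q + 1) * (q + 1))) ^ J ≤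
          n ^ ab.1 * n ^ ab.2 * (J * J * ((q + 1) * (q + 1))) ^ J := Nat.mul_le_mul (Nat.mul_le_mul h1 h2) h3
      have h5 : ((n.choose ab.1 * n.choose ab.2 * (ab.1 * ab.2 * ((q + 1) * (q + 1))) ^ J : ℕ) : ℝ) ≤
          ((n ^ ab.1 * n ^ ab.2 * (J * J * ((q + 1) * (q + 1))) ^ J : ℕ) : ℝ) := by exact_mod_cast h4
      refine (le_trans (by exact_mod_cast h) h5).trans (le_of_eq ?_)
      rw [hK]; push_cast; ring
    have hpow : (n : ℝ) ^ (ab.1 + ab.2) / x ^ (ab.1 + ab.2 + 1) ≤ ((n : ℝ) / x) ^ (2 * J) / x := by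
      rw [pow_succ, ← div_div, ← div_pow]
      exact div_le_div_of_nonneg_right (pow_le_pow_right₀ hnx (by omega)) hx0.le
    calc (((univ : Finset ((i : Fin k) → Fin (mv i) → SlyWCycle n q ((i : ℕ) + 1))).filter fun F =>
            (slyFamPlusVerts F).card = ab.1 ∧ (slyFamMinusVerts F).card = ab.2).card : ℝ) * (Ntot / x ^ (ab.1 + ab.2 + 1))
        ≤ ((n : ℝ) ^ (ab.1 + ab.2) * K) * (Ntot / x ^ (ab.1 + ab.2 + 1)) :=
          mul_le_mul_of_nonneg_right hcount (div_nonneg hNtot0.le (pow_nonneg hx0.le _))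
      _ = Ntot * (K * ((n : ℝ) ^ (ab.1 + ab.2) / x ^ (ab.1 + ab.2 + 1))) := by ring
      _ ≤ Ntot * (K * (((n : ℝ) / x) ^ (2 * J) / x)) :=
          mul_le_mul_of_nonneg_left (mul_le_mul_of_nonneg_left hpow hK0) hNtot0.le
  calc _ ≤ ∑ F : (i : Fin k) → Fin (mv i) → SlyWCycle n q ((i : ℕ) + 1), Ntot / x ^ ((slyFamPlusVerts F).card + (slyFamMinusVerts F).card + 1) :=
        Finset.sum_le_sum fun F _ => hterm F
    _ = _ := hfib
    _ ≤ ∑ _ab ∈ (Finset.range (J + 1)) ×ˢ (Finset.range (J + 1)), Ntot * (K * (((n : ℝ) / x) ^ (2 * J) / x)) := Finset.sum_le_sum hab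
    _ = Ntot * ((((J + 1) ^ 2 : ℕ) : ℝ) * K * (((n : ℝ) / x) ^ (2 * J) / x)) := by
        rw [Finset.sum_const, Finset.card_product, Finset.card_range, nsmul_eq_mul]; push_cast; ring

open scoped Classical in
/-- **Upper bound on the joint factorial moments of the cycle counts** (Sly's Lemma 3.7, joint version,
upper half, all `n`): with `J = Σ_i mv_i (i+1)`, `x = n - 2J`,
`E[Π_i (2(i+1))^{mv i} (X_{2(i+1)})_{mv i}] ≤ Π_i (q^{2(i+1)}+q)^{mv i} (n/x)^{2J} + (J+1)² (J²(q+1)²)^J (n/x)^{2J}/x`.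
[cite: Sly2010, Lemma 3.7] -/
theorem avg_prod_slyDistinctTuples_le (mv : Fin k → ℕ) (hn : 2 * slyFamJ mv < n) :
    (∑ ω : (Fin q → Equiv.Perm (Fin (n + m'))) × Equiv.Perm (Fin n),
        ((∏ i : Fin k, slyDistinctTuples n m' q ((i : ℕ) + 1) (mv i) ω.1 ω.2 : ℕ) : ℝ)) /
        ((((n + m').factorial : ℝ) ^ q) * (n.factorial : ℝ)) ≤
      (∏ i : Fin k, ((q : ℝ) ^ (2 * ((i : ℕ) + 1)) + q) ^ (mv i)) * ((n : ℝ) / ((n : ℝ) - 2 * slyFamJ mv)) ^ (2 * slyFamJ mv) +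
        (((slyFamJ mv + 1) ^ 2 : ℕ) : ℝ) * (((slyFamJ mv * slyFamJ mv * ((q + 1) * (q + 1))) ^ slyFamJ mv : ℕ) : ℝ) *
          (((n : ℝ) / ((n : ℝ) - 2 * slyFamJ mv)) ^ (2 * slyFamJ mv) / ((n : ℝ) - 2 * slyFamJ mv)) := by
  have hN : (0 : ℝ) < (((n + m').factorial : ℝ) ^ q) * (n.factorial : ℝ) := by
    have h1 : (0 : ℝ) < (n + m').factorial := by exact_mod_cast Nat.factorial_pos _
    have h2 : (0 : ℝ) < n.factorial := by exact_mod_cast Nat.factorial_pos _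
    positivity
  have hsum : (∑ ω : (Fin q → Equiv.Perm (Fin (n + m'))) × Equiv.Perm (Fin n),
      ((∏ i : Fin k, slyDistinctTuples n m' q ((i : ℕ) + 1) (mv i) ω.1 ω.2 : ℕ) : ℝ)) =
      (∑ F : (i : Fin k) → Fin (mv i) → SlyWCycle n q ((i : ℕ) + 1), if SlyFamDistinct F ∧ SlyFamDisjoint F then
          (Fintype.card {ω : (Fin q → Equiv.Perm (Fin (n + m'))) × Equiv.Perm (Fin n) // ∀ i a, (F i a).Present ω.1 ω.2} : ℝ) else 0) +
        ∑ F : (i : Fin k) → Fin (mv i) → SlyWCycle n q ((i : ℕ) + 1), if SlyFamDistinct F ∧ ¬SlyFamDisjoint F then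
          (Fintype.card {ω : (Fin q → Equiv.Perm (Fin (n + m'))) × Equiv.Perm (Fin n) // ∀ i a, (F i a).Present ω.1 ω.2} : ℝ) else 0 := by
    have h := sum_prod_slyDistinctTuples (n := n) (m' := m') (q := q) mv
    have h' : (∑ ω : (Fin q → Equiv.Perm (Fin (n + m'))) × Equiv.Perm (Fin n),
        ((∏ i : Fin k, slyDistinctTuples n m' q ((i : ℕ) + 1) (mv i) ω.1 ω.2 : ℕ) : ℝ)) =
        ∑ F : (i : Fin k) → Fin (mv i) → SlyWCycle n q ((i : ℕ) + 1), if SlyFamDistinct F then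
          (Fintype.card {ω : (Fin q → Equiv.Perm (Fin (n + m'))) × Equiv.Perm (Fin n) // ∀ i a, (F i a).Present ω.1 ω.2} : ℝ) else 0 := by
      have := congrArg (fun x : ℕ => (x : ℝ)) h
      push_cast at this ⊢
      exact this
    rw [h', ← Finset.sum_add_distrib]
    refine Finset.sum_congr rfl fun F _ => ?_
    by_cases hd : SlyFamDistinct F
    · by_cases hv : SlyFamDisjoint F
      · rw [if_pos hd, if_pos ⟨hd, hv⟩, if_neg (fun h => h.2 hv), add_zero]
      · rw [if_pos hd, if_neg (fun h => hv h.2), if_pos ⟨hd, hv⟩, zero_add]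
    · rw [if_neg hd, if_neg (fun h => hd h.1), if_neg (fun h => hd h.1), add_zero]
  have hdisj : (∑ F : (i : Fin k) → Fin (mv i) → SlyWCycle n q ((i : ℕ) + 1), if SlyFamDistinct F ∧ SlyFamDisjoint F then
      (Fintype.card {ω : (Fin q → Equiv.Perm (Fin (n + m'))) × Equiv.Perm (Fin n) // ∀ i a, (F i a).Present ω.1 ω.2} : ℝ) else 0) ≤
      ∑ F : (i : Fin k) → Fin (mv i) → SlyWCycle n q ((i : ℕ) + 1), if SlyFamDisjoint F then
        (((∏ c : Fin q, (n + m' - ∑ p : (Σ i : Fin k, Fin (mv i)), (F p.1 p.2).colourCount (some c)).factorial) *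
          (n - ∑ p : (Σ i : Fin k, Fin (mv i)), (F p.1 p.2).colourCount none).factorial : ℕ) : ℝ) else 0 := by
    refine Finset.sum_le_sum fun F _ => ?_
    by_cases hv : SlyFamDisjoint F
    · rw [if_pos hv]
      split_ifs
      · rw [card_present_family F hv]
      · exact Nat.cast_nonneg _
    · rw [if_neg hv, if_neg (fun h => hv h.2)]
  rw [hsum, add_div]
  refine add_le_add ((div_le_div_of_nonneg_right hdisj hN.le).trans (sum_famDisjoint_div_bounds mv hn).2) ?_
  rw [div_le_iff₀ hN]
  refine (sum_famOverlap_le (m' := m') mv hn).trans (le_of_eq ?_)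
  ring

end FamilyOverlapBound

end Literature.Computability.Complexity
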